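import Literature.MathematicalPhysics.QuantumLattice.FermionNestedRegionPartitionFunction
import Literature.MathematicalPhysics.QuantumLattice.VariationalPressureBoxPartitionFunctionBound
import HarnessLib

/-!
# THE FREE-BOUNDARY PRESSURE EXISTS for every Hermitian, even, translation-covariant finite-range lattice-fermion interaction:
# `n^{-d} log Re Tr e^{−βH^Ψ_{[0,n)^d}}` converges (`β ≥ 0`, `d ≥ 1`), and the limit dominates the variational pressure

Topic `Literature/MathematicalPhysics/QuantumLattice` (family `hubbard`; crew hubbard-fast S2 «T > 0 / families of models»). The van Hove / box version of
Bratteli–Robinson II §6.2.4 for the CAR algebra, assembled from the two finite-volume laws of this session: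
`|log Z_{[0,km)^d} − k^d log Z_{[0,m)^d} − β(k^d−1)c| ≤ βk^d·col(m)·S_Ψ` (`FermionBoxTilingPartitionFunction`) and
`|log Z_{[0,n)^d} − log Z_{[0,km)^d} − 2(n^d − (km)^d) log 2| ≤ β(n^d − (km)^d)S_Ψ` (`FermionNestedRegionPartitionFunction`), `c = Re(Ψ∅)_{∅∅}`,
`col(m) = |thicken_R([0,m)^d) ∖ [0,m)^d| ≤ (m+2⌊R⌋)^d − m^d`:

* `abs_boxLogPartitionFn_div_sub_le` — for `1 ≤ m ≤ n`: `|a_n − b_m| ≤ β·S_Ψ·col(m)/m^d + C_m/n` with `a_n = n^{-d} log Re Z_n`,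
  `b_m = (log Re Z_m + βc)/m^d`, `C_m = d·m·(|b_m| + 2 log 2 + βS_Ψ) + β|c|`;
* **`cauchySeq_boxLogPartitionFn_div`**, **`exists_tendsto_boxLogPartitionFn_div`** — the sequence is Cauchy, hence converges: THE FREE-BOUNDARY PRESSURE
  `P_free(β,Ψ) = lim_n n^{-d} log Re Z_{[0,n)^d}` EXISTS;
* `exists_tendsto_and_varPressure_le` — and `P(β,Ψ) ≤ P_free(β,Ψ)` for the variational pressure of `TIVariationalPressure`
  (`VariationalPressureBoxPartitionFunctionBound.varPressure_le_of_limit`).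

Everything is PROVED; no definition, no named fact, no number. HONEST SCOPE: free boundary conditions along the boxes `[0,n)^d`; the converse inequality
`P_free ≤ P` (full Gibbs variational principle) needs product states over box tilings and is not claimed (for the `t–t'` Hubbard model it is
`TIVariationalPressure` §4).

## Mathlib / tree search

REUSED: `abs_log_partitionFn_box_sub_le`, `abs_log_partitionFn_box_sub_box_le`, `card_thicken_halfOpenBox_sdiff_le`, `varPressure_le_of_limit`;
Mathlib `Metric.cauchySeq_iff'`, `cauchySeq_tendsto_of_complete`, `one_add_mul_le_pow`, `Nat.lt_div_mul_add`, `tendsto_const_div_atTop_nhds_zero_nat`.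

## References

* O. Bratteli, D. W. Robinson, *OAQSM 2* (1997), §6.2.4 (existence of the pressure, Prop. 6.2.39 ff.). [cite: BratteliRobinsonII1997, §6.2.4 (Prop. 6.2.39 ff.)]
* R. B. Israel, *Convexity in the Theory of Lattice Gases* (1979), Thm. I.2.3 (existence of the pressure by box subadditivity). [cite: Israel1979, Thm. I.2.4]
-/

noncomputable section

open scoped ComplexOrder BigOperators Matrix.Norms.L2Operator
open Finset

namespace Literature.MathematicalPhysics.QuantumLattice

open Matrix HubbardWave0 Literature.Probability.LatticeModels ThermodynamicLimit
open _root_.Filter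
open scoped _root_.Topology

namespace FermionInteraction

variable {d : ℕ} {Ψ : FermionInteraction d} {R : ℝ}

/-- `1 − x^d ≤ d(1 − x)` for `x ≥ 0` (Bernoulli). [cite: NielsenChuang2010, §11.3.4] -/
private theorem one_sub_pow_le (x : ℝ) (hx : 0 ≤ x) (d : ℕ) : 1 - x ^ d ≤ d * (1 - x) := by
  have h := one_add_mul_le_pow (a := x - 1) (by linarith) d
  have e : (1 : ℝ) + (x - 1) = x := by ring
  rw [e] at h
  linarith

/-- **THE TWO-SCALE ESTIMATE**: for `1 ≤ m ≤ n` (`β ≥ 0`, `d ≥ 1`), with `a_n = n^{-d} log Re Z_n`, `b_m = (log Re Z_m + βc)/m^d`, `c = Re(Ψ∅)_{∅∅}`: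
`|a_n − b_m| ≤ β S_Ψ col(m)/m^d + (d m (|b_m| + 2 log 2 + β S_Ψ) + β|c|)/n`. [cite: BratteliRobinsonII1997, §6.2.4 (Prop. 6.2.39 ff.)] -/
theorem abs_boxLogPartitionFn_div_sub_le (hd : 0 < d) (hH : Ψ.IsHermitian) (hE : Ψ.IsEven) (hT : Ψ.IsTranslationInvariant)
    (hR : Ψ.HasFiniteRange R) {β : ℝ} (hβ : 0 ≤ β) {m n : ℕ} (hm : 1 ≤ m) (hmn : m ≤ n) :
    |Real.log (Matrix.partitionFn β (Ψ.localHamiltonian (halfOpenBox d n))).re / (n : ℝ) ^ d -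
        (Real.log (Matrix.partitionFn β (Ψ.localHamiltonian (halfOpenBox d m))).re + β * ((Ψ.Φ ∅) ∅ ∅).re) / (m : ℝ) ^ d| ≤
      β * (∑ X ∈ (thicken ({0} : Finset (Site d)) R).powerset with (0 : Site d) ∈ X, ‖Ψ.Φ X‖) *
          (((thicken (halfOpenBox d m) R \ halfOpenBox d m).card : ℝ) / (m : ℝ) ^ d) +
        (d * m * (|(Real.log (Matrix.partitionFn β (Ψ.localHamiltonian (halfOpenBox d m))).re + β * ((Ψ.Φ ∅) ∅ ∅).re) / (m : ℝ) ^ d| +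
            2 * Real.log 2 + β * ∑ X ∈ (thicken ({0} : Finset (Site d)) R).powerset with (0 : Site d) ∈ X, ‖Ψ.Φ X‖) +
          β * |((Ψ.Φ ∅) ∅ ∅).re|) / n := by
  -- abbreviations
  set S : ℝ := ∑ X ∈ (thicken ({0} : Finset (Site d)) R).powerset with (0 : Site d) ∈ X, ‖Ψ.Φ X‖ with hS
  set c : ℝ := ((Ψ.Φ ∅) ∅ ∅).re with hc
  set col : ℝ := ((thicken (halfOpenBox d m) R \ halfOpenBox d m).card : ℝ) with hcol
  set Lm : ℝ := Real.log (Matrix.partitionFn β (Ψ.localHamiltonian (halfOpenBox d m))).re with hLm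
  set Ln : ℝ := Real.log (Matrix.partitionFn β (Ψ.localHamiltonian (halfOpenBox d n))).re with hLn
  set k : ℕ := n / m with hk
  set Lkm : ℝ := Real.log (Matrix.partitionFn β (Ψ.localHamiltonian (halfOpenBox d (k * m)))).re with hLkm
  have hS0 : 0 ≤ S := Finset.sum_nonneg fun _ _ => norm_nonneg _
  have hcol0 : 0 ≤ col := Nat.cast_nonneg _
  have hn : 1 ≤ n := hm.trans hmn
  have hn0 : (0 : ℝ) < n := by exact_mod_cast hn
  have hm0 : (0 : ℝ) < m := by exact_mod_cast hm
  have hnd : (0 : ℝ) < (n : ℝ) ^ d := by positivity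
  have hmd : (0 : ℝ) < (m : ℝ) ^ d := by positivity
  have hkm : k * m ≤ n := Nat.div_mul_le_self n m
  have hlt : n < k * m + m := Nat.lt_div_mul_add (by omega)
  -- the two finite-volume laws
  have hT' := abs_log_partitionFn_box_sub_le hH hE hT hR hm k hβ
  have hF' := abs_log_partitionFn_box_sub_box_le hH hT hR hkm hβ (d := d)
  rw [← hLkm, ← hLm, ← hc, ← hS, ← hcol] at hT'
  rw [← hLn, ← hLkm, ← hS] at hF'
  push_cast at hF'
  clear_value Lkm Ln Lm col c S k
  -- the ratio `x = km/n`
  obtain ⟨x, hx⟩ : ∃ x : ℝ, x = ((k : ℝ) * m) / n := ⟨_, rfl⟩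
  have hx0 : 0 ≤ x := by rw [hx]; positivity
  have hx1 : x ≤ 1 := by rw [hx, div_le_one hn0]; exact_mod_cast hkm
  have h1x : 1 - x ≤ (m : ℝ) / n := by
    rw [hx, sub_le_iff_le_add, ← add_div, le_div_iff₀ hn0, one_mul]
    have : ((n : ℕ) : ℝ) ≤ (((k * m + m : ℕ)) : ℝ) := by exact_mod_cast hlt.le
    push_cast at this; linarith
  have hxd1 : x ^ d ≤ 1 := pow_le_one₀ hx0 hx1
  have h1xd : 1 - x ^ d ≤ d * ((m : ℝ) / n) := (one_sub_pow_le x hx0 d).trans (mul_le_mul_of_nonneg_left h1x (Nat.cast_nonneg d))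
  have h1xd0 : 0 ≤ 1 - x ^ d := by linarith
  have hkx : ((k : ℝ) * m) ^ d = x ^ d * (n : ℝ) ^ d := by rw [hx, div_pow, div_mul_cancel₀ _ hnd.ne']
  have hkd : (k : ℝ) ^ d = x ^ d * (n : ℝ) ^ d / (m : ℝ) ^ d := by
    rw [← hkx, mul_pow, mul_div_assoc, div_self hmd.ne', mul_one]
  -- combine: `Ln = x^d n^d b_m − βc + 2(1 − x^d) n^d log 2 + e`, `|e| ≤ β (x^d n^d col S/m^d + (1 − x^d) n^d S)`
  obtain ⟨bm, hbm⟩ : ∃ b : ℝ, b = (Lm + β * c) / (m : ℝ) ^ d := ⟨_, rfl⟩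
  have hLm' : Lm + β * c = bm * (m : ℝ) ^ d := by rw [hbm, div_mul_cancel₀ _ hmd.ne']
  rw [abs_le] at hT' hF'
  have e1 : (k : ℝ) ^ d * Lm + β * (((k : ℝ) ^ d - 1) * c) = x ^ d * (n : ℝ) ^ d * bm - β * c := by
    rw [hkd]
    have : x ^ d * (n : ℝ) ^ d / (m : ℝ) ^ d * Lm + β * ((x ^ d * (n : ℝ) ^ d / (m : ℝ) ^ d - 1) * c) =
        x ^ d * (n : ℝ) ^ d * ((Lm + β * c) / (m : ℝ) ^ d) - β * c := by
      field_simp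
      ring
    rw [this, ← hbm]
  -- the pieces
  set E1 : ℝ := Lkm - (k : ℝ) ^ d * Lm - β * (((k : ℝ) ^ d - 1) * c) with hE1
  set E2 : ℝ := Ln - Lkm - 2 * ((n : ℝ) ^ d - ((k : ℝ) * m) ^ d) * Real.log 2 with hE2
  clear_value E1 E2
  have hLn : Ln - (n : ℝ) ^ d * bm =
      E1 + E2 - (1 - x ^ d) * (n : ℝ) ^ d * bm - β * c + 2 * ((1 - x ^ d) * (n : ℝ) ^ d) * Real.log 2 := by
    rw [hE1, hE2, hkx]
    linear_combination e1
  have hA1 : |E1| ≤ β * S * col / (m : ℝ) ^ d * (n : ℝ) ^ d := by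
    refine (abs_le.2 ⟨hT'.1, hT'.2⟩).trans ?_
    rw [hkd]
    have hle : x ^ d * (n : ℝ) ^ d / (m : ℝ) ^ d * (col * S) ≤ (n : ℝ) ^ d / (m : ℝ) ^ d * (col * S) := by
      have h1 : x ^ d * (n : ℝ) ^ d ≤ (n : ℝ) ^ d := mul_le_of_le_one_left hnd.le hxd1
      exact mul_le_mul_of_nonneg_right (div_le_div_of_nonneg_right h1 hmd.le) (mul_nonneg hcol0 hS0)
    have := mul_le_mul_of_nonneg_left hle hβ
    have e : β * S * col / (m : ℝ) ^ d * (n : ℝ) ^ d = β * ((n : ℝ) ^ d / (m : ℝ) ^ d * (col * S)) := by ring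
    rw [e]
    exact this
  have hA2 : |E2| ≤ β * ((1 - x ^ d) * (n : ℝ) ^ d) * S := by
    refine (abs_le.2 ⟨hF'.1, hF'.2⟩).trans (le_of_eq ?_)
    rw [hkx]; ring
  have hA3 : |(1 - x ^ d) * (n : ℝ) ^ d * bm| = (1 - x ^ d) * (n : ℝ) ^ d * |bm| := by
    rw [abs_mul, abs_of_nonneg (mul_nonneg h1xd0 hnd.le)]
  have hA4 : |β * c| = β * |c| := by rw [abs_mul, abs_of_nonneg hβ]
  have hlog2 : 0 ≤ Real.log 2 := Real.log_nonneg (by norm_num)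
  have hP : 0 ≤ (1 - x ^ d) * (n : ℝ) ^ d := mul_nonneg h1xd0 hnd.le
  have b1 := abs_le.1 (le_of_eq hA3)
  have b2 := abs_le.1 (le_of_eq hA4)
  have b3 := abs_le.1 hA1
  have b4 := abs_le.1 hA2
  have hmain : |Ln - (n : ℝ) ^ d * bm| ≤
      (n : ℝ) ^ d * (β * S * (col / (m : ℝ) ^ d) + (1 - x ^ d) * (|bm| + 2 * Real.log 2 + β * S)) + β * |c| := by
    rw [hLn, abs_le]
    have e : (n : ℝ) ^ d * (β * S * (col / (m : ℝ) ^ d) + (1 - x ^ d) * (|bm| + 2 * Real.log 2 + β * S)) + β * |c| =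
        β * S * col / (m : ℝ) ^ d * (n : ℝ) ^ d + β * ((1 - x ^ d) * (n : ℝ) ^ d) * S + (1 - x ^ d) * (n : ℝ) ^ d * |bm| + β * |c| +
          2 * ((1 - x ^ d) * (n : ℝ) ^ d) * Real.log 2 := by ring
    rw [e]
    constructor
    · linarith [b1.1, b2.2, b3.1, b4.1, mul_nonneg hP hlog2]
    · linarith [b1.2, b2.1, b3.2, b4.2, mul_nonneg hP hlog2]
  have key : |Ln / (n : ℝ) ^ d - bm| ≤ β * S * (col / (m : ℝ) ^ d) + (1 - x ^ d) * (|bm| + 2 * Real.log 2 + β * S) + β * |c| / (n : ℝ) ^ d := by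
    have e : Ln / (n : ℝ) ^ d - bm = (Ln - (n : ℝ) ^ d * bm) / (n : ℝ) ^ d := by field_simp
    rw [e, abs_div, abs_of_pos hnd, div_le_iff₀ hnd]
    have e2 : (β * S * (col / (m : ℝ) ^ d) + (1 - x ^ d) * (|bm| + 2 * Real.log 2 + β * S) + β * |c| / (n : ℝ) ^ d) * (n : ℝ) ^ d =
        (n : ℝ) ^ d * (β * S * (col / (m : ℝ) ^ d) + (1 - x ^ d) * (|bm| + 2 * Real.log 2 + β * S)) + β * |c| := by
      field_simp
    rw [e2]
    exact hmain
  -- finish: `(1 − x^d) ≤ d m / n`, `1/n^d ≤ 1/n`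
  have hA0 : 0 ≤ |bm| + 2 * Real.log 2 + β * S := by
    have := Real.log_nonneg (show (1:ℝ) ≤ 2 by norm_num); positivity
  have hinv : β * |c| / (n : ℝ) ^ d ≤ β * |c| / n :=
    div_le_div_of_nonneg_left (by positivity) hn0 (le_self_pow₀ (by exact_mod_cast hn) (ne_of_gt hd))
  have h2 : (1 - x ^ d) * (|bm| + 2 * Real.log 2 + β * S) ≤ d * ((m : ℝ) / n) * (|bm| + 2 * Real.log 2 + β * S) :=
    mul_le_mul_of_nonneg_right h1xd hA0
  rw [hbm] at key h2
  have efin : ((d : ℝ) * m * (|(Lm + β * c) / (m : ℝ) ^ d| + 2 * Real.log 2 + β * S) + β * |c|) / n =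
      d * ((m : ℝ) / n) * (|(Lm + β * c) / (m : ℝ) ^ d| + 2 * Real.log 2 + β * S) + β * |c| / n := by
    field_simp
  rw [efin]
  linarith [key, h2, hinv]

/-- The collar-per-volume of the boxes vanishes: `|thicken_R([0,m)^d) ∖ [0,m)^d| / m^d → 0`. [cite: BratteliKishimotoRobinson1978, Thm. 2 (proof, p. 48)] -/
theorem tendsto_collar_div_pow (hd : 0 < d) (R : ℝ) :
    Tendsto (fun m : ℕ => (((thicken (halfOpenBox d m) R \ halfOpenBox d m).card : ℝ)) / (m : ℝ) ^ d) atTop (𝓝 0) := by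
  set r : ℕ := 2 * ⌊R⌋₊ with hr
  have hratio : Tendsto (fun n : ℕ => (((n : ℝ) + r) ^ d - (n : ℝ) ^ d) / ((n : ℝ) ^ d)) atTop (𝓝 0) := by
    have h1 : Tendsto (fun n : ℕ => ((n : ℝ) + r) / n) atTop (𝓝 1) := by
      have : Tendsto (fun n : ℕ => 1 + (r : ℝ) / n) atTop (𝓝 (1 + 0)) :=
        tendsto_const_nhds.add (tendsto_const_div_atTop_nhds_zero_nat _)
      rw [add_zero] at this
      refine this.congr' ?_
      filter_upwards [Filter.eventually_ge_atTop 1] with n hn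
      have hn0 : (n : ℝ) ≠ 0 := by exact_mod_cast (by omega : n ≠ 0)
      field_simp
    have h2 : Tendsto (fun n : ℕ => (((n : ℝ) + r) / n) ^ d - 1) atTop (𝓝 (1 ^ d - 1)) := (h1.pow d).sub tendsto_const_nhds
    rw [one_pow, sub_self] at h2
    refine h2.congr' ?_
    filter_upwards [Filter.eventually_ge_atTop 1] with n hn
    have hn0 : (n : ℝ) ^ d ≠ 0 := pow_ne_zero _ (by exact_mod_cast (by omega : n ≠ 0))
    rw [div_pow, sub_div, div_self hn0]
  refine squeeze_zero (fun m => by positivity) (fun m => ?_) hratio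
  rcases Nat.eq_zero_or_pos m with rfl | hm
  · rw [Nat.cast_zero, zero_pow (ne_of_gt hd), div_zero, div_zero]
  · have hmd : (0 : ℝ) < (m : ℝ) ^ d := by positivity
    refine div_le_div_of_nonneg_right ?_ hmd.le
    have h := card_thicken_halfOpenBox_sdiff_le (d := d) m R
    have hle : m ^ d ≤ (m + r) ^ d := Nat.pow_le_pow_left (Nat.le_add_right m r) d
    have : (((thicken (halfOpenBox d m) R \ halfOpenBox d m).card : ℕ) : ℝ) ≤ (((m + 2 * ⌊R⌋₊) ^ d - m ^ d : ℕ) : ℝ) := by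
      exact_mod_cast h
    rw [← hr, Nat.cast_sub hle] at this
    push_cast at this
    exact this

/-- **THE FREE-BOUNDARY PRESSURE SEQUENCE IS CAUCHY** (`β ≥ 0`, `d ≥ 1`, `Ψ` Hermitian, even, translation covariant, finite range).
[cite: BratteliRobinsonII1997, §6.2.4 (Prop. 6.2.39 ff.)] [cite: Israel1979, Thm. I.2.4] -/
theorem cauchySeq_boxLogPartitionFn_div (hd : 0 < d) (hH : Ψ.IsHermitian) (hE : Ψ.IsEven) (hT : Ψ.IsTranslationInvariant)
    (hR : Ψ.HasFiniteRange R) {β : ℝ} (hβ : 0 ≤ β) :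
    CauchySeq fun n : ℕ => Real.log (Matrix.partitionFn β (Ψ.localHamiltonian (halfOpenBox d n))).re / (n : ℝ) ^ d := by
  set a : ℕ → ℝ := fun n => Real.log (Matrix.partitionFn β (Ψ.localHamiltonian (halfOpenBox d n))).re / (n : ℝ) ^ d with ha
  set S : ℝ := ∑ X ∈ (thicken ({0} : Finset (Site d)) R).powerset with (0 : Site d) ∈ X, ‖Ψ.Φ X‖ with hS
  set c : ℝ := ((Ψ.Φ ∅) ∅ ∅).re with hc
  set b : ℕ → ℝ := fun m => (Real.log (Matrix.partitionFn β (Ψ.localHamiltonian (halfOpenBox d m))).re + β * c) / (m : ℝ) ^ d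
    with hb
  set δ : ℕ → ℝ := fun m => β * S * ((((thicken (halfOpenBox d m) R \ halfOpenBox d m).card : ℝ)) / (m : ℝ) ^ d) with hδ
  set C : ℕ → ℝ := fun m => d * m * (|b m| + 2 * Real.log 2 + β * S) + β * |c| with hC
  have hest : ∀ m n : ℕ, 1 ≤ m → m ≤ n → |a n - b m| ≤ δ m + C m / n := fun m n hm hmn =>
    abs_boxLogPartitionFn_div_sub_le hd hH hE hT hR hβ hm hmn
  have hδ0 : Tendsto δ atTop (𝓝 0) := by
    have h := (tendsto_collar_div_pow hd R).const_mul (β * S)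
    rw [mul_zero] at h
    exact h
  rw [Metric.cauchySeq_iff']
  intro ε hε
  -- choose the coarse scale `m`
  obtain ⟨m, hm⟩ : ∃ m : ℕ, 1 ≤ m ∧ |δ m| < ε / 4 := by
    have h := (Metric.tendsto_atTop.1 hδ0) (ε / 4) (by linarith)
    obtain ⟨M, hM⟩ := h
    refine ⟨max M 1, le_max_right _ _, ?_⟩
    have := hM (max M 1) (le_max_left _ _)
    rwa [Real.dist_eq, sub_zero] at this
  -- choose `N ≥ m` with `C m / N < ε/4`
  have hCm0 : 0 ≤ C m := by
    have := Real.log_nonneg (show (1:ℝ) ≤ 2 by norm_num)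
    have hS0 : 0 ≤ S := Finset.sum_nonneg fun _ _ => norm_nonneg _
    rw [hC]; positivity
  obtain ⟨N, hNm, hN⟩ : ∃ N : ℕ, m ≤ N ∧ C m / N < ε / 4 := by
    have h := (Metric.tendsto_atTop.1 (tendsto_const_div_atTop_nhds_zero_nat (C m))) (ε / 4) (by linarith)
    obtain ⟨M, hM⟩ := h
    refine ⟨max M m, le_max_right _ _, ?_⟩
    have := hM (max M m) (le_max_left _ _)
    rw [Real.dist_eq, sub_zero] at this
    exact lt_of_abs_lt this
  refine ⟨N, fun n hn => ?_⟩
  rw [Real.dist_eq]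
  have h1 := hest m n hm.1 (hNm.trans hn)
  have h2 := hest m N hm.1 hNm
  have hN0 : (0 : ℝ) < N := by exact_mod_cast (hm.1.trans hNm)
  have hn0 : (0 : ℝ) < n := by exact_mod_cast (hm.1.trans (hNm.trans hn))
  have h3 : C m / n ≤ C m / N := div_le_div_of_nonneg_left hCm0 hN0 (by exact_mod_cast hn)
  have h4 := (abs_lt.1 hm.2)
  calc |a n - a N| = |(a n - b m) - (a N - b m)| := by ring_nf
    _ ≤ |a n - b m| + |a N - b m| := abs_sub _ _
    _ < ε := by linarith

/-- **THE FREE-BOUNDARY PRESSURE EXISTS**: `n^{-d} log Re Tr e^{−βH^Ψ_{[0,n)^d}} → P_free(β,Ψ)` for some real `P_free`.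
[cite: BratteliRobinsonII1997, §6.2.4 (Prop. 6.2.39 ff.)] [cite: Israel1979, Thm. I.2.4] -/
theorem exists_tendsto_boxLogPartitionFn_div (hd : 0 < d) (hH : Ψ.IsHermitian) (hE : Ψ.IsEven) (hT : Ψ.IsTranslationInvariant)
    (hR : Ψ.HasFiniteRange R) {β : ℝ} (hβ : 0 ≤ β) :
    ∃ P : ℝ, Tendsto (fun n : ℕ => Real.log (Matrix.partitionFn β (Ψ.localHamiltonian (halfOpenBox d n))).re / (n : ℝ) ^ d) atTop (𝓝 P) :=
  cauchySeq_tendsto_of_complete (cauchySeq_boxLogPartitionFn_div hd hH hE hT hR hβ)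

/-- **…and dominates the variational pressure**: `P(β,Ψ) ≤ P_free(β,Ψ)` (any range parameter `R` of `Ψ`).
[cite: BratteliRobinsonII1997, Thm. 6.2.40] -/
theorem exists_tendsto_and_varPressure_le (hd : 0 < d) (hH : Ψ.IsHermitian) (hE : Ψ.IsEven) (hT : Ψ.IsTranslationInvariant)
    (hR : Ψ.HasFiniteRange R) {β : ℝ} (hβ : 0 ≤ β) :
    ∃ P : ℝ, Tendsto (fun n : ℕ => Real.log (Matrix.partitionFn β (Ψ.localHamiltonian (halfOpenBox d n))).re / (n : ℝ) ^ d) atTop (𝓝 P) ∧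
      Ψ.varPressure β R ≤ P := by
  obtain ⟨P, hP⟩ := exists_tendsto_boxLogPartitionFn_div hd hH hE hT hR hβ
  exact ⟨P, hP, InfVolFermionState.varPressure_le_of_limit hd hH hT hR β hP⟩

end FermionInteraction

end Literature.MathematicalPhysics.QuantumLattice

end
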